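import Summits.ResolutionOfSingularities.ResolutionOfSingularities.Theorems.FrobeniusLadderFRationalResolutionSuspensionLocalClause
import Summits.ResolutionOfSingularities.ResolutionOfSingularities.Theorems.FrobeniusLadderFRationalResolutionRegularQuotientIff
import Summits.ResolutionOfSingularities.ResolutionOfSingularities.Theorems.FrobeniusLadderFRationalResolutionSqTransfer
import Mathlib.RingTheory.RegularLocalRing.Polynomial
import HarnessLib

/-!
# Suspension calibration, IV: the singular locus of `Σf` is `Sing V(f) × {y = z = 0}`

Support file for crux stmt-ResolutionOfSingularities-15317 (`FrobeniusLadder.FRationalResolution`),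
line `Sketch`, continuation seat c2, wave 3 — calibration note Claim B as theorems, for every field `k`:

* `sumAlgEquiv_symm_comp_C` — `e.symm ∘ C = rename Sum.inr` for `e = MvPolynomial.sumAlgEquiv k (Fin 2) (Fin n)`;
* `suspension_isRegularLocalRing_iff` — at a prime `P ∋ y, z` through `Σf = {yz + f = 0}` (`f ≠ 0`), the
  local ring of `Σf` is regular IFF the local ring of the hypersurface `V(f) ⊂ 𝔸ⁿ` at `𝔮 = P ∩ k[x]`
  is regular (both are "equation not in the symbolic square", `stub_isRegularLocalRing_quotient_iff`;
  transfer along `y, z ↦ 0`, `stub_sq_transfer_constantCoeff`);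
* `suspension_isRegularLocalRing_of_notMem` — off `{y = z = 0}` the suspension is regular (Jacobian lemma
  `algebraMap_notMem_maximalIdeal_sq`, `∂g/∂z = y`, `∂g/∂y = z`).

So the residual class member `Σf` (calibration III) carries EXACTLY the singularities of `V(f)`, two
dimensions down.
-/

-- single-problem summit: the doubled namespace component `ResolutionOfSingularities` is forced
set_option linter.dupNamespace false

noncomputable section

open Literature.AlgebraicGeometry.Resolution Literature.RingTheory.TightClosure

namespace Summit.ResolutionOfSingularities.ResolutionOfSingularities.Theorems.FRationalResolution

section SingularLocus

open MvPolynomial IsLocalRing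

variable (k : Type) [Field k] (n : ℕ)

/-- `e.symm ∘ C = rename Sum.inr` for `e = MvPolynomial.sumAlgEquiv k (Fin 2) (Fin n)`. -/
theorem sumAlgEquiv_symm_comp_C :
    ((sumAlgEquiv k (Fin 2) (Fin n)).symm : MvPolynomial (Fin 2) (MvPolynomial (Fin n) k) →+*
        MvPolynomial (Fin 2 ⊕ Fin n) k).comp (C : MvPolynomial (Fin n) k →+* _) =
      (rename Sum.inr : MvPolynomial (Fin n) k →ₐ[k] MvPolynomial (Fin 2 ⊕ Fin n) k) := by
  refine RingHom.ext fun a => ?_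
  have h := congrArg (fun φ => φ a)
    (sumAlgEquiv_comp_rename_inr (R := k) (S₁ := Fin 2) (S₂ := Fin n))
  simp only [AlgHom.coe_comp, Function.comp_apply, IsScalarTower.coe_toAlgHom', algebraMap_eq] at h
  change (sumAlgEquiv k (Fin 2) (Fin n)).symm (C a) = rename Sum.inr a
  rw [← h]
  exact (sumAlgEquiv k (Fin 2) (Fin n)).symm_apply_apply _

/-- **The singular locus of the suspension is the singular locus of the hypersurface, two dimensions
down** (calibration note, Claim B). For every field `k`, `f ≠ 0` in `k[x₁..xₙ]`, and every prime `P`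
of `S = k[y,z,x₁..xₙ]` through which `Σf = {yz + f = 0}` passes with `y, z ∈ P`: the local ring of
`Σf` at `P` is regular IFF the local ring of the hypersurface `V(f) ⊂ 𝔸ⁿ` at `𝔮 = P ∩ k[x]` is
regular. (At primes with `y ∉ P` or `z ∉ P`, `Σf` is regular: `stub_clause_of_derivation` /
`algebraMap_notMem_maximalIdeal_sq`.) Both sides are "the equation is not in the symbolic square"
(`stub_isRegularLocalRing_quotient_iff`), and `g ∈ P⁽²⁾ ⟺ f ∈ 𝔮⁽²⁾` along `y, z ↦ 0`
(`stub_sq_transfer_constantCoeff`, through `MvPolynomial.sumAlgEquiv`). -/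
theorem suspension_isRegularLocalRing_iff (f : MvPolynomial (Fin n) k) (hf : f ≠ 0)
    (P : Ideal (MvPolynomial (Fin 2 ⊕ Fin n) k)) [P.IsPrime]
    (hgP : (X (Sum.inl 0) * X (Sum.inl 1) + rename Sum.inr f : MvPolynomial (Fin 2 ⊕ Fin n) k) ∈ P)
    (h0 : (X (Sum.inl 0) : MvPolynomial (Fin 2 ⊕ Fin n) k) ∈ P)
    (h1 : (X (Sum.inl 1) : MvPolynomial (Fin 2 ⊕ Fin n) k) ∈ P) :
    IsRegularLocalRing (Localization.AtPrime P ⧸ Ideal.span {algebraMap (MvPolynomial (Fin 2 ⊕ Fin n) k)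
      (Localization.AtPrime P) (X (Sum.inl 0) * X (Sum.inl 1) + rename Sum.inr f)}) ↔
    IsRegularLocalRing (Localization.AtPrime
        (P.comap (rename Sum.inr : MvPolynomial (Fin n) k →ₐ[k] MvPolynomial (Fin 2 ⊕ Fin n) k)) ⧸
      Ideal.span {algebraMap (MvPolynomial (Fin n) k) (Localization.AtPrime
        (P.comap (rename Sum.inr : MvPolynomial (Fin n) k →ₐ[k] MvPolynomial (Fin 2 ⊕ Fin n) k))) f}) := by
  set e := sumAlgEquiv k (Fin 2) (Fin n) with he
  set g₂ : MvPolynomial (Fin 2) (MvPolynomial (Fin n) k) := X 0 * X 1 + C f with hg₂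
  have heg : e (X (Sum.inl 0) * X (Sum.inl 1) + rename Sum.inr f) = g₂ := sumAlgEquiv_suspension k n f
  have hegs : e.symm g₂ = X (Sum.inl 0) * X (Sum.inl 1) + rename Sum.inr f := by
    rw [← heg, e.symm_apply_apply]
  -- `g ≠ 0` (its `z`-derivative is `y`)
  have hg0 : (X (Sum.inl 0) * X (Sum.inl 1) + rename Sum.inr f : MvPolynomial (Fin 2 ⊕ Fin n) k) ≠ 0 := by
    intro h0'
    have := (pderiv_suspension k n f).1
    rw [h0', map_zero] at this
    exact X_ne_zero (Sum.inl 0) this.symm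
  -- `f ∈ 𝔮`
  have hfq : f ∈ P.comap (rename Sum.inr : MvPolynomial (Fin n) k →ₐ[k] MvPolynomial (Fin 2 ⊕ Fin n) k) := by
    rw [Ideal.mem_comap]
    have : (rename Sum.inr f : MvPolynomial (Fin 2 ⊕ Fin n) k) =
        (X (Sum.inl 0) * X (Sum.inl 1) + rename Sum.inr f) - X (Sum.inl 0) * X (Sum.inl 1) := by ring
    rw [this]
    exact P.sub_mem hgP (P.mul_mem_left _ h1)
  -- both sides: "the equation is not in the symbolic square"
  rw [stub_isRegularLocalRing_quotient_iff (MvPolynomial (Fin 2 ⊕ Fin n) k) P _ hgP hg0,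
    stub_isRegularLocalRing_quotient_iff (MvPolynomial (Fin n) k) _ f hfq hf]
  refine not_congr ?_
  -- the prime `P₂ = e(P)` of `A[y,z]`
  set P₂ : Ideal (MvPolynomial (Fin 2) (MvPolynomial (Fin n) k)) :=
    P.comap (e.symm : MvPolynomial (Fin 2) (MvPolynomial (Fin n) k) →+* MvPolynomial (Fin 2 ⊕ Fin n) k)
    with hP₂
  have hmem : ∀ w, w ∈ P₂ ↔ e.symm w ∈ P := fun w => Ideal.mem_comap
  haveI : P₂.IsPrime := Ideal.comap_isPrime _ _
  have hX0 : (X 0 : MvPolynomial (Fin 2) (MvPolynomial (Fin n) k)) ∈ P₂ := by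
    rw [hmem, he, sumAlgEquiv_symm_X]; exact h0
  have hX1 : (X 1 : MvPolynomial (Fin 2) (MvPolynomial (Fin n) k)) ∈ P₂ := by
    rw [hmem, he, sumAlgEquiv_symm_X]; exact h1
  have hq : P₂.comap (C : MvPolynomial (Fin n) k →+* MvPolynomial (Fin 2) (MvPolynomial (Fin n) k)) =
      P.comap (rename Sum.inr : MvPolynomial (Fin n) k →ₐ[k] MvPolynomial (Fin 2 ⊕ Fin n) k) := by
    rw [hP₂, Ideal.comap_comap, sumAlgEquiv_symm_comp_C]
    rfl
  have M := stub_sq_transfer_constantCoeff (MvPolynomial (Fin n) k) f P₂ hX0 hX1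
  rw [hq] at M
  rw [← M]
  -- squares correspond under `e`
  have hsq1 : ∀ s, s ∈ P ^ 2 → e s ∈ P₂ ^ 2 := by
    intro s hs
    rw [pow_two] at hs ⊢
    refine Submodule.mul_induction_on hs (fun a ha b hb => ?_) (fun x y hx hy => ?_)
    · rw [map_mul]
      refine Ideal.mul_mem_mul ?_ ?_
      · rw [hmem]; rwa [e.symm_apply_apply]
      · rw [hmem]; rwa [e.symm_apply_apply]
    · rw [map_add]; exact Ideal.add_mem _ hx hy
  have hsq2 : ∀ w, w ∈ P₂ ^ 2 → e.symm w ∈ P ^ 2 := by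
    intro w hw
    rw [pow_two] at hw ⊢
    refine Submodule.mul_induction_on hw (fun a ha b hb => ?_) (fun x y hx hy => ?_)
    · rw [map_mul]
      exact Ideal.mul_mem_mul ((hmem a).mp ha) ((hmem b).mp hb)
    · rw [map_add]; exact Ideal.add_mem _ hx hy
  constructor
  · rintro ⟨u, hu, hug⟩
    refine ⟨e u, ?_, ?_⟩
    · rw [hmem]; rwa [e.symm_apply_apply]
    · have := hsq1 _ hug
      rwa [map_mul, heg] at this
  · rintro ⟨u₂, hu₂, h⟩
    refine ⟨e.symm u₂, (hmem u₂).not.mp hu₂, ?_⟩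
    have := hsq2 _ h
    rwa [map_mul, hegs] at this

/-- **The suspension is regular off `{y = z = 0}`**: at a prime `P ∋ yz + f` with `y ∉ P` or
`z ∉ P` the local ring of `Σf` is a regular local ring (`∂g/∂z = y`, `∂g/∂y = z`, Jacobian lemma
`algebraMap_notMem_maximalIdeal_sq` of p133842, and `IsRegularLocalRing.quotient_span_singleton`). With
`suspension_isRegularLocalRing_iff` this is calibration Claim B in full:
`Sing(Σf) = Sing(V(f)) × {y = z = 0}`. -/
theorem suspension_isRegularLocalRing_of_notMem (f : MvPolynomial (Fin n) k)
    (P : Ideal (MvPolynomial (Fin 2 ⊕ Fin n) k)) [P.IsPrime]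
    (hgP : (X (Sum.inl 0) * X (Sum.inl 1) + rename Sum.inr f : MvPolynomial (Fin 2 ⊕ Fin n) k) ∈ P)
    (h : (X (Sum.inl 0) : MvPolynomial (Fin 2 ⊕ Fin n) k) ∉ P ∨
      (X (Sum.inl 1) : MvPolynomial (Fin 2 ⊕ Fin n) k) ∉ P) :
    IsRegularLocalRing (Localization.AtPrime P ⧸ Ideal.span {algebraMap (MvPolynomial (Fin 2 ⊕ Fin n) k)
      (Localization.AtPrime P) (X (Sum.inl 0) * X (Sum.inl 1) + rename Sum.inr f)}) := by
  have hmem : algebraMap (MvPolynomial (Fin 2 ⊕ Fin n) k) (Localization.AtPrime P)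
      (X (Sum.inl 0) * X (Sum.inl 1) + rename Sum.inr f) ∈ maximalIdeal (Localization.AtPrime P) := by
    rw [← Localization.AtPrime.map_eq_maximalIdeal]
    exact Ideal.mem_map_of_mem _ hgP
  rcases h with h0 | h1
  · have hsq := algebraMap_notMem_maximalIdeal_sq P (pderiv (Sum.inl 1) : Derivation k _ _) hgP
      (by rw [(pderiv_suspension k n f).1]; exact h0)
    exact (IsRegularLocalRing.quotient_span_singleton hmem hsq).1
  · have hsq := algebraMap_notMem_maximalIdeal_sq P (pderiv (Sum.inl 0) : Derivation k _ _) hgP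
      (by rw [(pderiv_suspension k n f).2]; exact h1)
    exact (IsRegularLocalRing.quotient_span_singleton hmem hsq).1

end SingularLocus

end Summit.ResolutionOfSingularities.ResolutionOfSingularities.Theorems.FRationalResolution

end
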